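import Summits.KontsevichZagierPeriods.KontsevichZagierPeriods.Theorems.FermatIsogenyFermatSectorCompleteKernelForm

/-!
# `FermatSectorComplete` (stmt-KontsevichZagierPeriods-14252), line `birth` — the only shape of a
# refutation: separating invariants (lead c8, `--supports`)

By the kernel form (`FermatSectorCompleteKernelForm.fermatSectorComplete_iff_ker_le`) the crux says
`ker eval ≤ relations ⊔ closure (S_lin ∪ S_prod)`. Hence:

* `not_fermatSectorComplete_of_separating_invariant` — an additive invariant `φ : FormalRep →+ A`
  killing the four move sets (`relations ≤ ker φ`) and every β-pair, but NOT the difference of some two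
  representations of equal value, refutes the crux (and with it Conjecture 1 off the β-sector);
* `fermatSectorComplete_iff_invariants` — conversely this is the ONLY shape of a refutation: the crux
  holds iff every such invariant kills `ker eval` (take `φ` = the quotient map by the β-sector subgroup).

This is the typed interface route Neg's programme (a move-invariant separating an accessible off-sector
pair: an MZV, polylogarithm or elliptic-period identity) has to instantiate against THIS crux.
References: Kontsevich–Zagier 2001 §1.2; Huber–Müller-Stach 2017, Conj. 13.2.1.
-/

noncomputable section

namespace Summit.KontsevichZagierPeriods.FermatIsogeny.FermatSectorCompleteInvariants

open Literature.NumberTheory.Transcendental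
open Literature.NumberTheory.Transcendental.KZ
open Summit.KontsevichZagierPeriods.KontsevichZagierPeriods.Theses.FermatIsogeny (FermatSectorComplete)
open Summit.KontsevichZagierPeriods.FermatIsogeny.FermatSectorCompleteKernelForm
  (fermatSectorComplete_iff_ker_le)

/-- **A separating invariant refutes the crux.** If an additive map `φ` on the formal group kills the
relations and every β-linear / β-product pair difference, and `φ ([r] − [r']) ≠ 0` for two
representations of equal value, then `FermatSectorComplete` fails. [cite: KontsevichZagier2001, §1.2 Conjecture 1] -/
theorem not_fermatSectorComplete_of_separating_invariant :
    ∀ {A : Type*} [AddCommGroup A] (φ : Literature.NumberTheory.Transcendental.KZ.FormalRep →+ A), Literature.NumberTheory.Transcendental.KZ.relations ≤ φ.ker → ({z : Literature.NumberTheory.Transcendental.KZ.FormalRep | ∃ (a b a' b' : ℚ) (c : ℝ) (ρ ρ' : Literature.NumberTheory.Transcendental.KZ.IntegralRep 1), 0 < a ∧ 0 < b ∧ 0 < a' ∧ 0 < b' ∧ IsAlgebraic ℚ c ∧ ρ.domain = {x | x 0 ∈ Set.Ioo (0:ℝ) 1} ∧ Set.EqOn ρ.integrand (fun x => (x 0)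 ^ ((a:ℝ) - 1) * (1 - x 0) ^ ((b:ℝ) - 1)) ρ.domain ∧ ρ'.domain = {x | x 0 ∈ Set.Ioo (0:ℝ) 1} ∧ Set.EqOn ρ'.integrand (fun x => c * (x 0) ^ ((a':ℝ) - 1) * (1 - x 0) ^ ((b':ℝ) - 1)) ρ'.domain ∧ ρ.value = ρ'.value ∧ z = Literature.NumberTheory.Transcendental.KZ.of ρ - Literature.NumberTheory.Transcendental.KZ.of ρ'} ∪ {z : Literature.NumberTheory.Transcendental.KZ.FormalRep | ∃ (a b e d a' b' e' d' : ℚ) (q : ℝ) (ρ ρ' : Literature.NumberTheory.Transcendental.KZ.IntegralRep 2), 0 < a ∧ 0 < b ∧ 0 < e ∧ 0 < d ∧ 0 < a' ∧ 0 < b' ∧ 0 < e' ∧ 0 < d' ∧ IsAlgebraic ℚ q ∧ ρ.domain = {x | ∀ i, x i ∈ Set.Ioo (0:ℝ) 1} ∧ Set.EqOn ρ.integrand (fun x => (x 0) ^ ((a:ℝ) - 1) * (1 - x 0) ^ ((b:ℝ) - 1) * (x 1) ^ ((e:ℝ) - 1) * (1 - x 1) ^ ((d:ℝ) - 1)) ρ.domain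 ∧ ρ'.domain = {x | ∀ i, x i ∈ Set.Ioo (0:ℝ) 1} ∧ Set.EqOn ρ'.integrand (fun x => q * (x 0) ^ ((a':ℝ) - 1) * (1 - x 0) ^ ((b':ℝ) - 1) * (x 1) ^ ((e':ℝ) - 1) * (1 - x 1) ^ ((d':ℝ) - 1)) ρ'.domain ∧ ρ.value = ρ'.value ∧ z = Literature.NumberTheory.Transcendental.KZ.of ρ - Literature.NumberTheory.Transcendental.KZ.of ρ'}) ⊆ φ.ker → ∀ {n m : ℕ} (r : Literature.NumberTheory.Transcendental.KZ.IntegralRep n) (r' : Literature.NumberTheory.Transcendental.KZ.IntegralRep m), r.value = r'.value → φ (Literature.NumberTheory.Transcendental.KZ.of r - Literature.NumberTheory.Transcendental.KZ.of r') ≠ 0 → ¬ Summit.KontsevichZagierPeriods.KontsevichZagierPeriods.Theses.FermatIsogeny.FermatSectorComplete := by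
  intro A _ φ hrel hS n m r r' hv hne h
  have hle : Literature.NumberTheory.Transcendental.KZ.relations ⊔ AddSubgroup.closure ({z : Literature.NumberTheory.Transcendental.KZ.FormalRep | ∃ (a b a' b' : ℚ) (c : ℝ) (ρ ρ' : Literature.NumberTheory.Transcendental.KZ.IntegralRep 1), 0 < a ∧ 0 < b ∧ 0 < a' ∧ 0 < b' ∧ IsAlgebraic ℚ c ∧ ρ.domain = {x | x 0 ∈ Set.Ioo (0:ℝ) 1} ∧ Set.EqOn ρ.integrand (fun x => (x 0) ^ ((a:ℝ) - 1) * (1 - x 0) ^ ((b:ℝ) - 1)) ρ.domain ∧ ρ'.domain = {x | x 0 ∈ Set.Ioo (0:ℝ) 1} ∧ Set.EqOn ρ'.integrand (fun x => c * (x 0) ^ ((a':ℝ) - 1) * (1 - x 0) ^ ((b':ℝ) - 1)) ρ'.domain ∧ ρ.value = ρ'.value ∧ z = Literature.NumberTheory.Transcendental.KZ.of ρ - Literature.NumberTheory.Transcendental.KZ.of ρ'} ∪ {z : Literature.NumberTheory.Transcendental.KZ.FormalRep | ∃ (a b e d a' b' e' d' : ℚ) (q : ℝ) (ρ ρ' :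 Literature.NumberTheory.Transcendental.KZ.IntegralRep 2), 0 < a ∧ 0 < b ∧ 0 < e ∧ 0 < d ∧ 0 < a' ∧ 0 < b' ∧ 0 < e' ∧ 0 < d' ∧ IsAlgebraic ℚ q ∧ ρ.domain = {x | ∀ i, x i ∈ Set.Ioo (0:ℝ) 1} ∧ Set.EqOn ρ.integrand (fun x => (x 0) ^ ((a:ℝ) - 1) * (1 - x 0) ^ ((b:ℝ) - 1) * (x 1) ^ ((e:ℝ) - 1) * (1 - x 1) ^ ((d:ℝ) - 1)) ρ.domain ∧ ρ'.domain = {x | ∀ i, x i ∈ Set.Ioo (0:ℝ) 1} ∧ Set.EqOn ρ'.integrand (fun x => q * (x 0) ^ ((a':ℝ) - 1) * (1 - x 0) ^ ((b':ℝ) - 1) * (x 1) ^ ((e':ℝ) - 1) * (1 - x 1) ^ ((d':ℝ) - 1)) ρ'.domain ∧ ρ.value = ρ'.value ∧ z = Literature.NumberTheory.Transcendental.KZ.of ρ - Literature.NumberTheory.Transcendental.KZ.of ρ'}) ≤ φ.ker := sup_le hrel ((AddSubgroup.closure_le _).mpr hS)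
  have hker : of r - of r' ∈ eval.ker := by
    show eval (of r - of r') = 0
    rw [eval_of_sub_of, hv, sub_self]
  exact hne (hle (fermatSectorComplete_iff_ker_le.mp h hker))

/-- **The only shape of a refutation.** `FermatSectorComplete` holds iff every additive invariant of the
formal group that kills the relations and the β-pairs kills every formal combination of value `0`
(`→`: kernel form; `←`: the quotient map by the β-sector subgroup is such an invariant, with kernel
exactly that subgroup). [cite: KontsevichZagier2001, §1.2 Conjecture 1] -/
theorem fermatSectorComplete_iff_invariants :
    FermatSectorComplete ↔
      ∀ φ : FormalRep →+ FormalRep ⧸ (Literature.NumberTheory.Transcendental.KZ.relations ⊔ AddSubgroup.closure ({z : Literature.NumberTheory.Transcendental.KZ.FormalRep | ∃ (a b a' b' : ℚ) (c : ℝ) (ρ ρ' : Literature.NumberTheory.Transcendental.KZ.IntegralRep 1), 0 < a ∧ 0 < b ∧ 0 < a' ∧ 0 < b' ∧ IsAlgebraic ℚ c ∧ ρ.domain = {x | x 0 ∈ Set.Ioo (0:ℝ) 1} ∧ Set.EqOn ρ.integrand (fun x => (x 0) ^ ((a:ℝ) - 1) * (1 - x 0) ^ ((b:ℝ) - 1))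 ρ.domain ∧ ρ'.domain = {x | x 0 ∈ Set.Ioo (0:ℝ) 1} ∧ Set.EqOn ρ'.integrand (fun x => c * (x 0) ^ ((a':ℝ) - 1) * (1 - x 0) ^ ((b':ℝ) - 1)) ρ'.domain ∧ ρ.value = ρ'.value ∧ z = Literature.NumberTheory.Transcendental.KZ.of ρ - Literature.NumberTheory.Transcendental.KZ.of ρ'} ∪ {z : Literature.NumberTheory.Transcendental.KZ.FormalRep | ∃ (a b e d a' b' e' d' : ℚ) (q : ℝ) (ρ ρ' : Literature.NumberTheory.Transcendental.KZ.IntegralRep 2), 0 < a ∧ 0 < b ∧ 0 < e ∧ 0 < d ∧ 0 < a' ∧ 0 < b' ∧ 0 < e' ∧ 0 < d' ∧ IsAlgebraic ℚ q ∧ ρ.domain = {x | ∀ i, x i ∈ Set.Ioo (0:ℝ) 1} ∧ Set.EqOn ρ.integrand (fun x => (x 0) ^ ((a:ℝ) - 1) * (1 - x 0) ^ ((b:ℝ) - 1) * (x 1) ^ ((e:ℝ) - 1) * (1 - x 1) ^ ((d:ℝ) - 1)) ρ.domain ∧ ρ'.domain = {x | ∀ i, x i ∈ Set.Ioo (0:ℝ)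 1} ∧ Set.EqOn ρ'.integrand (fun x => q * (x 0) ^ ((a':ℝ) - 1) * (1 - x 0) ^ ((b':ℝ) - 1) * (x 1) ^ ((e':ℝ) - 1) * (1 - x 1) ^ ((d':ℝ) - 1)) ρ'.domain ∧ ρ.value = ρ'.value ∧ z = Literature.NumberTheory.Transcendental.KZ.of ρ - Literature.NumberTheory.Transcendental.KZ.of ρ'})),
        Literature.NumberTheory.Transcendental.KZ.relations ≤ φ.ker → ({z : Literature.NumberTheory.Transcendental.KZ.FormalRep | ∃ (a b a' b' : ℚ) (c : ℝ) (ρ ρ' : Literature.NumberTheory.Transcendental.KZ.IntegralRep 1), 0 < a ∧ 0 < b ∧ 0 < a' ∧ 0 < b' ∧ IsAlgebraic ℚ c ∧ ρ.domain = {x | x 0 ∈ Set.Ioo (0:ℝ) 1} ∧ Set.EqOn ρ.integrand (fun x => (x 0) ^ ((a:ℝ) - 1) * (1 - x 0) ^ ((b:ℝ) - 1)) ρ.domain ∧ ρ'.domain = {x | x 0 ∈ Set.Ioo (0:ℝ) 1} ∧ Set.EqOn ρ'.integrand (fun x => c * (x 0) ^ ((a':ℝ) - 1) * (1 - x 0)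 ^ ((b':ℝ) - 1)) ρ'.domain ∧ ρ.value = ρ'.value ∧ z = Literature.NumberTheory.Transcendental.KZ.of ρ - Literature.NumberTheory.Transcendental.KZ.of ρ'} ∪ {z : Literature.NumberTheory.Transcendental.KZ.FormalRep | ∃ (a b e d a' b' e' d' : ℚ) (q : ℝ) (ρ ρ' : Literature.NumberTheory.Transcendental.KZ.IntegralRep 2), 0 < a ∧ 0 < b ∧ 0 < e ∧ 0 < d ∧ 0 < a' ∧ 0 < b' ∧ 0 < e' ∧ 0 < d' ∧ IsAlgebraic ℚ q ∧ ρ.domain = {x | ∀ i, x i ∈ Set.Ioo (0:ℝ) 1} ∧ Set.EqOn ρ.integrand (fun x => (x 0) ^ ((a:ℝ) - 1) * (1 - x 0) ^ ((b:ℝ) - 1) * (x 1) ^ ((e:ℝ) - 1) * (1 - x 1) ^ ((d:ℝ) - 1)) ρ.domain ∧ ρ'.domain = {x | ∀ i, x i ∈ Set.Ioo (0:ℝ) 1} ∧ Set.EqOn ρ'.integrand (fun x => q * (x 0) ^ ((a':ℝ) - 1) * (1 - x 0) ^ ((b':ℝ) - 1) * (x 1) ^ ((e':ℝ) - 1) *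 (1 - x 1) ^ ((d':ℝ) - 1)) ρ'.domain ∧ ρ.value = ρ'.value ∧ z = Literature.NumberTheory.Transcendental.KZ.of ρ - Literature.NumberTheory.Transcendental.KZ.of ρ'}) ⊆ φ.ker → eval.ker ≤ φ.ker := by
  constructor
  · intro h φ hrel hS c hc
    exact (sup_le hrel ((AddSubgroup.closure_le _).mpr hS)) (fermatSectorComplete_iff_ker_le.mp h hc)
  · intro h
    refine fermatSectorComplete_iff_ker_le.mpr ?_
    intro c hc
    have hk := h (QuotientAddGroup.mk' _) ?_ ?_ hc
    · rwa [QuotientAddGroup.ker_mk'] at hk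
    · rw [QuotientAddGroup.ker_mk']
      exact le_sup_left
    · rw [QuotientAddGroup.ker_mk']
      exact fun z hz => AddSubgroup.mem_sup_right (AddSubgroup.subset_closure hz)

/-- The general-codomain form of `←`: if every invariant into EVERY abelian group killing relations and
β-pairs kills `ker eval`, the crux holds (specialise to the quotient map). [folklore] -/
theorem fermatSectorComplete_of_forall_invariants
    (h : ∀ (A : Type) [AddCommGroup A] (φ : FormalRep →+ A),
      Literature.NumberTheory.Transcendental.KZ.relations ≤ φ.ker → ({z : Literature.NumberTheory.Transcendental.KZ.FormalRep | ∃ (a b a' b' : ℚ) (c : ℝ) (ρ ρ' : Literature.NumberTheory.Transcendental.KZ.IntegralRep 1), 0 < a ∧ 0 < b ∧ 0 < a' ∧ 0 < b' ∧ IsAlgebraic ℚ c ∧ ρ.domain = {x | x 0 ∈ Set.Ioo (0:ℝ) 1} ∧ Set.EqOn ρ.integrand (fun x => (x 0) ^ ((a:ℝ) - 1) * (1 - x 0) ^ ((b:ℝ) - 1)) ρ.domain ∧ ρ'.domain = {x | x 0 ∈ Set.Ioo (0:ℝ) 1} ∧ Set.EqOn ρ'.integrand (fun x => c * (x 0) ^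 ((a':ℝ) - 1) * (1 - x 0) ^ ((b':ℝ) - 1)) ρ'.domain ∧ ρ.value = ρ'.value ∧ z = Literature.NumberTheory.Transcendental.KZ.of ρ - Literature.NumberTheory.Transcendental.KZ.of ρ'} ∪ {z : Literature.NumberTheory.Transcendental.KZ.FormalRep | ∃ (a b e d a' b' e' d' : ℚ) (q : ℝ) (ρ ρ' : Literature.NumberTheory.Transcendental.KZ.IntegralRep 2), 0 < a ∧ 0 < b ∧ 0 < e ∧ 0 < d ∧ 0 < a' ∧ 0 < b' ∧ 0 < e' ∧ 0 < d' ∧ IsAlgebraic ℚ q ∧ ρ.domain = {x | ∀ i, x i ∈ Set.Ioo (0:ℝ) 1} ∧ Set.EqOn ρ.integrand (fun x => (x 0) ^ ((a:ℝ) - 1) * (1 - x 0) ^ ((b:ℝ) - 1) * (x 1) ^ ((e:ℝ) - 1) * (1 - x 1) ^ ((d:ℝ) - 1)) ρ.domain ∧ ρ'.domain = {x | ∀ i, x i ∈ Set.Ioo (0:ℝ) 1} ∧ Set.EqOn ρ'.integrand (fun x => q * (x 0) ^ ((a':ℝ) - 1) * (1 - x 0) ^ ((b':ℝ) - 1) *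 (x 1) ^ ((e':ℝ) - 1) * (1 - x 1) ^ ((d':ℝ) - 1)) ρ'.domain ∧ ρ.value = ρ'.value ∧ z = Literature.NumberTheory.Transcendental.KZ.of ρ - Literature.NumberTheory.Transcendental.KZ.of ρ'}) ⊆ φ.ker → eval.ker ≤ φ.ker) :
    FermatSectorComplete :=
  fermatSectorComplete_iff_invariants.mpr fun φ hrel hS => h _ φ hrel hS

end Summit.KontsevichZagierPeriods.FermatIsogeny.FermatSectorCompleteInvariants

end
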